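import Summits.NavierStokesRegularity.NavierStokesRegularity.Theorems.SwirlFreeBudget
import HarnessLib

/-!
# SwirlFreeBudget, toward crux K-18.1 `EtaMoserBound` (T-18.2): the exponent count of memo
# Appendix A.6–A.7 — the sub-cylinder Moser bound at `R₂ = 5R/6` is `K(1+A)^K √E R⁻³`
# (seat nsreg-p4 g12)

Support file for the DORMANT route `SwirlThreshold` (crux stmt-NavierStokesRegularity-2002) and
planner nsreg-p2's ROUND-18 Appendix A ("EXPONENT COUNT … the total power of `R₂` in (A.7) is `-3`
for EVERY `p` (dimensional consistency: `η` has parabolic dimension `-3`, `A`, `E` are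
dimensionless)").  Pure real arithmetic: the bound delivered by `exists_abs_angVortQuot_le_sub`
(`…EtaMoserCore`) at `R₂ = 5R/6`, inner radius `3R₂/4 = 5R/8`, start exponent `p = 2/3`,
`c · ((16N₁²R₂²)^{5/4}16^{15/8})³ · ((2R₂E₂)^{1/3}(4πR₂⁴)^{2/3})^{3/2} / (R₂/4)^{15}` with
`N₁ = N(1 + (6/5)A)`, `E₂ = (6/5)E`, is at most `K (1+A)^K √E / R³` for an explicit `K = K(c, N)`
(`exists_coreBound_le`).

WHAT THIS IS NOT: not NS regularity — arithmetic; `EtaMoserBound` stays OPEN; no crux claim.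
-/

namespace Summit.NavierStokesRegularity.NavierStokesRegularity.Theorems.SwirlFreeBudget

open Real

noncomputable section

/-- `(a · R^s)^t = a^t · R^{st}` for `a, R ≥ 0`. -/
theorem mul_rpow_rpow {a R s t : ℝ} (ha : 0 ≤ a) (hR : 0 ≤ R) :
    (a * R ^ s) ^ t = a ^ t * R ^ (s * t) := by
  rw [Real.mul_rpow ha (Real.rpow_nonneg hR s), ← Real.rpow_mul hR]

/-- **The exponent count.**  For `c, N > 0` there is `K = K(c, N) > 0` such that for all
`A, E ≥ 0`, `R > 0`, with `R₂ = 5R/6`, the sub-cylinder Moser bound is `≤ K (1+A)^K √E / R³`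
(`K = max(C₁, 15/2)`, `C₁` the explicit product of the constants). -/
theorem exists_coreBound_le {c N : ℝ} (hc : 0 < c) (hN : 0 < N) :
    ∃ K : ℝ, 0 < K ∧ ∀ A E R : ℝ, 0 ≤ A → 0 ≤ E → 0 < R →
    c * ((16 * (N * (1 + R / (5 * R / 6) * A)) ^ 2 * (5 * R / 6) ^ 2) ^ (5 / 4 : ℝ) * 16 ^ (15 / 8 : ℝ)) ^ (3 : ℝ) *
        ((2 * (5 * R / 6) * (R / (5 * R / 6) * E)) ^ (1 / 3 : ℝ) *
          (4 * Real.pi * (5 * R / 6) ^ 4) ^ (2 / 3 : ℝ)) ^ (3 / 2 : ℝ) /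
        (5 * R / 6 - 3 * (5 * R / 6) / 4) ^ (15 : ℝ) ≤
      K * (1 + A) ^ K * Real.sqrt E / R ^ 3 := by
  set Kc : ℝ := max (c * ((16 * (N * (6 / 5)) ^ 2 * (5 / 6 : ℝ) ^ 2) ^ (5 / 4 : ℝ) * 16 ^ (15 / 8 : ℝ)) ^ (3 : ℝ) *
      (Real.sqrt 2 * (4 * Real.pi * (5 / 6 : ℝ) ^ 4)) / (5 / 24 : ℝ) ^ (15 : ℝ)) (15 / 2) with hKc
  refine ⟨Kc, lt_of_lt_of_le (by norm_num) (le_max_right _ _), fun A E R hA hE hR => ?_⟩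
  have hR0 : 0 ≤ R := hR.le
  have hκ : R / (5 * R / 6) = 6 / 5 := by field_simp
  rw [hκ]
  have hP : 1 ≤ 1 + A := by linarith
  have hP0 : 0 < 1 + A := by linarith
  -- ### T1 = α₁(A) · R^{15/2}
  set y : ℝ := 16 * (N * (1 + 6 / 5 * A)) ^ 2 * (5 / 6 : ℝ) ^ 2 with hy
  have hy0 : 0 ≤ y := by positivity
  have hT1 : ((16 * (N * (1 + 6 / 5 * A)) ^ 2 * (5 * R / 6) ^ 2) ^ (5 / 4 : ℝ) * 16 ^ (15 / 8 : ℝ)) ^ (3 : ℝ)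
      = (y ^ (5 / 4 : ℝ) * 16 ^ (15 / 8 : ℝ)) ^ (3 : ℝ) * R ^ (15 / 2 : ℝ) := by
    have e1 : 16 * (N * (1 + 6 / 5 * A)) ^ 2 * (5 * R / 6) ^ 2 = y * R ^ (2 : ℝ) := by
      rw [hy, Real.rpow_two]; ring
    rw [e1, mul_rpow_rpow hy0 hR0, show (2 : ℝ) * (5 / 4) = 5 / 2 by norm_num,
      show y ^ (5 / 4 : ℝ) * R ^ (5 / 2 : ℝ) * 16 ^ (15 / 8 : ℝ) =
        (y ^ (5 / 4 : ℝ) * 16 ^ (15 / 8 : ℝ)) * R ^ (5 / 2 : ℝ) by ring,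
      mul_rpow_rpow (by positivity) hR0]
    norm_num
  -- ### T2 = β · √E · R^{9/2}  (β = √2 · 4π(5/6)⁴)
  have hT2 : ((2 * (5 * R / 6) * (6 / 5 * E)) ^ (1 / 3 : ℝ) * (4 * Real.pi * (5 * R / 6) ^ 4) ^ (2 / 3 : ℝ)) ^ (3 / 2 : ℝ)
      = Real.sqrt 2 * (4 * Real.pi * (5 / 6 : ℝ) ^ 4) * Real.sqrt E * R ^ (9 / 2 : ℝ) := by
    have e1 : 2 * (5 * R / 6) * (6 / 5 * E) = (2 * E) * R ^ (1 : ℝ) := by rw [Real.rpow_one]; ring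
    have e2 : 4 * Real.pi * (5 * R / 6) ^ 4 = (4 * Real.pi * (5 / 6 : ℝ) ^ 4) * R ^ (4 : ℝ) := by
      rw [show (4 : ℝ) = ((4 : ℕ) : ℝ) by norm_num, Real.rpow_natCast]; ring
    rw [e1, e2, mul_rpow_rpow (by positivity) hR0, mul_rpow_rpow (by positivity) hR0]
    have e3 : (2 * E) ^ (1 / 3 : ℝ) * R ^ ((1 : ℝ) * (1 / 3)) *
        ((4 * Real.pi * (5 / 6 : ℝ) ^ 4) ^ (2 / 3 : ℝ) * R ^ ((4 : ℝ) * (2 / 3))) =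
        ((2 * E) ^ (1 / 3 : ℝ) * (4 * Real.pi * (5 / 6 : ℝ) ^ 4) ^ (2 / 3 : ℝ)) * R ^ (3 : ℝ) := by
      rw [show ((2 * E) ^ (1 / 3 : ℝ) * (4 * Real.pi * (5 / 6 : ℝ) ^ 4) ^ (2 / 3 : ℝ)) * R ^ (3 : ℝ) =
        (2 * E) ^ (1 / 3 : ℝ) * (4 * Real.pi * (5 / 6 : ℝ) ^ 4) ^ (2 / 3 : ℝ) *
          (R ^ ((1 : ℝ) * (1 / 3)) * R ^ ((4 : ℝ) * (2 / 3))) by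
            rw [← Real.rpow_add hR]; norm_num]
      ring
    rw [e3, mul_rpow_rpow (by positivity) hR0, show (3 : ℝ) * (3 / 2) = 9 / 2 by norm_num,
      Real.mul_rpow (by positivity) (by positivity), ← Real.rpow_mul (by positivity),
      ← Real.rpow_mul (by positivity), show (1 / 3 : ℝ) * (3 / 2) = 1 / 2 by norm_num,
      show (2 / 3 : ℝ) * (3 / 2) = 1 by norm_num, Real.rpow_one,
      Real.mul_rpow (by norm_num) hE, ← Real.sqrt_eq_rpow, ← Real.sqrt_eq_rpow]
    ring
  -- ### T3 = (5/24)^15 · R^15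
  have hT3 : (5 * R / 6 - 3 * (5 * R / 6) / 4) ^ (15 : ℝ) = (5 / 24 : ℝ) ^ (15 : ℝ) * R ^ (15 : ℝ) := by
    rw [show 5 * R / 6 - 3 * (5 * R / 6) / 4 = (5 / 24 : ℝ) * R by ring, Real.mul_rpow (by norm_num) hR0]
  rw [hT1, hT2, hT3]
  -- ### the `A`-dependence: `α₁(A) ≤ α₁' (1+A)^{15/2}`
  set y' : ℝ := 16 * (N * (6 / 5)) ^ 2 * (5 / 6 : ℝ) ^ 2 with hy'
  have hy'0 : 0 ≤ y' := by positivity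
  have hyy' : y ≤ y' * (1 + A) ^ (2 : ℝ) := by
    rw [hy, hy', Real.rpow_two]
    have h1 : N * (1 + 6 / 5 * A) ≤ N * (6 / 5) * (1 + A) := by nlinarith
    have h0 : 0 ≤ N * (1 + 6 / 5 * A) := by positivity
    calc 16 * (N * (1 + 6 / 5 * A)) ^ 2 * (5 / 6 : ℝ) ^ 2
        ≤ 16 * (N * (6 / 5) * (1 + A)) ^ 2 * (5 / 6 : ℝ) ^ 2 := by gcongr
      _ = 16 * (N * (6 / 5)) ^ 2 * (5 / 6 : ℝ) ^ 2 * (1 + A) ^ 2 := by ring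
  have hα : (y ^ (5 / 4 : ℝ) * 16 ^ (15 / 8 : ℝ)) ^ (3 : ℝ) ≤
      (y' ^ (5 / 4 : ℝ) * 16 ^ (15 / 8 : ℝ)) ^ (3 : ℝ) * (1 + A) ^ (15 / 2 : ℝ) := by
    calc (y ^ (5 / 4 : ℝ) * 16 ^ (15 / 8 : ℝ)) ^ (3 : ℝ)
        ≤ ((y' * (1 + A) ^ (2 : ℝ)) ^ (5 / 4 : ℝ) * 16 ^ (15 / 8 : ℝ)) ^ (3 : ℝ) := by gcongr
      _ = (y' ^ (5 / 4 : ℝ) * 16 ^ (15 / 8 : ℝ)) ^ (3 : ℝ) * (1 + A) ^ (15 / 2 : ℝ) := by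
          rw [mul_rpow_rpow hy'0 hP0.le, show (2 : ℝ) * (5 / 4) = 5 / 2 by norm_num,
            show y' ^ (5 / 4 : ℝ) * (1 + A) ^ (5 / 2 : ℝ) * 16 ^ (15 / 8 : ℝ) =
              (y' ^ (5 / 4 : ℝ) * 16 ^ (15 / 8 : ℝ)) * (1 + A) ^ (5 / 2 : ℝ) by ring,
            mul_rpow_rpow (by positivity) hP0.le]
          norm_num
  -- ### the `R`-count: `R^{15/2} R^{9/2} / R^{15} = R^{-3}`
  have hRpow : R ^ (15 / 2 : ℝ) * R ^ (9 / 2 : ℝ) / R ^ (15 : ℝ) = 1 / R ^ 3 := by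
    rw [← Real.rpow_add hR, show (15 / 2 : ℝ) + 9 / 2 = 12 by norm_num, div_eq_iff (by positivity),
      show (15 : ℝ) = ((15 : ℕ) : ℝ) by norm_num, show (12 : ℝ) = ((12 : ℕ) : ℝ) by norm_num,
      Real.rpow_natCast, Real.rpow_natCast]
    field_simp
  -- ### assemble
  set C₁ : ℝ := c * (y' ^ (5 / 4 : ℝ) * 16 ^ (15 / 8 : ℝ)) ^ (3 : ℝ) *
    (Real.sqrt 2 * (4 * Real.pi * (5 / 6 : ℝ) ^ 4)) / (5 / 24 : ℝ) ^ (15 : ℝ) with hC₁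
  have hC₁0 : 0 ≤ C₁ := by positivity
  have hK₁ : C₁ ≤ Kc := by rw [hC₁, hy']; exact le_max_left _ _
  have hK₂ : (15 / 2 : ℝ) ≤ Kc := le_max_right _ _
  have hKpow : (1 + A) ^ (15 / 2 : ℝ) ≤ (1 + A) ^ Kc :=
    Real.rpow_le_rpow_of_exponent_le hP hK₂
  have h524 : (0 : ℝ) < (5 / 24 : ℝ) ^ (15 : ℝ) := by positivity
  calc c * ((y ^ (5 / 4 : ℝ) * 16 ^ (15 / 8 : ℝ)) ^ (3 : ℝ) * R ^ (15 / 2 : ℝ)) *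
        (Real.sqrt 2 * (4 * Real.pi * (5 / 6 : ℝ) ^ 4) * Real.sqrt E * R ^ (9 / 2 : ℝ)) /
        ((5 / 24 : ℝ) ^ (15 : ℝ) * R ^ (15 : ℝ))
      = c * (y ^ (5 / 4 : ℝ) * 16 ^ (15 / 8 : ℝ)) ^ (3 : ℝ) * (Real.sqrt 2 * (4 * Real.pi * (5 / 6 : ℝ) ^ 4)) /
          (5 / 24 : ℝ) ^ (15 : ℝ) * Real.sqrt E * (R ^ (15 / 2 : ℝ) * R ^ (9 / 2 : ℝ) / R ^ (15 : ℝ)) := by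
        field_simp
    _ ≤ c * ((y' ^ (5 / 4 : ℝ) * 16 ^ (15 / 8 : ℝ)) ^ (3 : ℝ) * (1 + A) ^ (15 / 2 : ℝ)) *
          (Real.sqrt 2 * (4 * Real.pi * (5 / 6 : ℝ) ^ 4)) /
          (5 / 24 : ℝ) ^ (15 : ℝ) * Real.sqrt E * (R ^ (15 / 2 : ℝ) * R ^ (9 / 2 : ℝ) / R ^ (15 : ℝ)) := by
        gcongr
    _ = C₁ * (1 + A) ^ (15 / 2 : ℝ) * Real.sqrt E / R ^ 3 := by
        rw [hRpow, hC₁]; ring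
    _ ≤ Kc * (1 + A) ^ Kc * Real.sqrt E / R ^ 3 := by
        have hsE : 0 ≤ Real.sqrt E := Real.sqrt_nonneg E
        have hR3 : 0 < R ^ 3 := by positivity
        refine div_le_div_of_nonneg_right ?_ hR3.le
        gcongr

end

end Summit.NavierStokesRegularity.NavierStokesRegularity.Theorems.SwirlFreeBudget
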